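import Mathlib.Analysis.Convex.SimplicialComplex.Basic
import Mathlib.Analysis.Convex.Combination
import Mathlib.Analysis.Convex.Topology
import Mathlib.Topology.Homeomorph.Lemmas
import Literature.NumberTheory.Transcendental.SemialgebraicMaps
import Literature.Barriers.KontsevichZagierPeriods.HauptvermutungObstruction
import HarnessLib

/-!
# Vocabulary for semialgebraic triangulations: open simplices, polyhedra, semialgebraic homeomorphisms

The light vocabulary in which the triangulation theorems for (compact) semialgebraic sets are printed
([Dries1998, Ch. 8 (1.4), (1.5), Def. (2.3), Thm. (2.9)]; [Shiota1997, §II.1 p. 97, Thm. II.2.1,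
Rem. II.2.4]; [Shiota2014, §1–§2]) — all of it PROVED. The triangulation theorems themselves are
deliberately not vendored in this file (see "What is NOT here").

## What is vendored

* `openSimplex 𝕜 s` — the open simplex `(a₀, …, a_k) = {∑ tᵢ aᵢ : all tᵢ > 0, ∑ tᵢ = 1}` spanned by a
  finite set of points [Dries1998, Ch. 8 (1.4)]; for the faces `s` of a (geometric) simplicial complex
  `K : Geometry.SimplicialComplex 𝕜 E` (Mathlib; = the "closed complexes" of [Dries1998, Ch. 8 (1.5)]) these
  are the open simplices of `K`, and `K.space = ⋃ convexHull s` is the polyhedron `|K|`.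
* Polyhedra: we REUSE `Literature.Barriers.KontsevichZagierPeriods.PL.IsPolyhedron` (finite union of
  geometric simplices = the "compact polyhedra" of [Shiota2014, §1–§2], "a compact polyhedron is a finite
  union of simplexes") and prove `isPolyhedron_space` (`|K|` of a finite complex is a polyhedron, via
  `isPolyhedron_biUnion_convexHull` converting vertex `Finset`s to `Fin (k+1)`-indexed families) and
  `IsPolyhedron.isCompact`. (This file imports the barrier file only for that PL vocabulary; a later
  librarian pass may move the vocabulary to a PL topic file.)
* `IsSemialgHomeomorphOn k S T Φ Ψ` — `Φ` restricts to a homeomorphism `S → T` with inverse `Ψ` and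
  `k`-semialgebraic graph over `S`: a "definable homeomorphism" [Dries1998, Ch. 8 (2.3)] / "𝔛-homeomorphism"
  for `𝔛` = the semialgebraic sets [Shiota1997, §II.1, p. 97] (`k = ℝ`); it is the maps-explicit form of
  `Literature.Barriers.KontsevichZagierPeriods.PL.SemialgHomeomorphicOver k S T = ∃ Φ Ψ, …` (which asks for
  both graphs): API `toHomeomorph`, `symm` (the graph of the inverse is the coordinate flip `finAddFlip`
  of the graph, proved), `refl`, and the bridges `IsSemialgHomeomorphOn.semialgHomeomorphicOver`,
  `semialgHomeomorphicOver_iff_exists` (proved: one semialgebraic graph suffices).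

## What is NOT here (and why)

* **The triangulation theorems are not vendored as named facts** (D-0026 bad-split review, 2026-08-15).
  This file was opened as "layer 1" of a decomposition of the semialgebraic Hauptvermutung
  `Literature.Barriers.KontsevichZagierPeriods.PL.SemialgebraicHauptvermutung` ([Shiota1997, Cor. III.1.4];
  [Shiota2014, Thm. 2.1]) and at first carried two named facts: the absolute triangulation theorem — *a
  compact semialgebraic `S ⊆ ℝᵐ` with semialgebraic subsets `S₁, …, S_k` admits a finite simplicial
  complex `K` in `ℝᵐ` and a semialgebraic homeomorphism `Φ : S → |K|` such that each `Sᵢ` is a union of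
  preimages of open simplices of `K`* [Dries1998, Ch. 8 Thm. (2.9) with Def. (2.3)]; [Shiota1997,
  Thm. II.2.1 with Rem. II.2.4] — and the relative, complex-preserving form — *given a finite simplicial
  complex `K` in `ℝⁿ` and compact semialgebraic `X₁, …, X_k ⊆ |K|`, there is a semialgebraic homeomorphism
  `τ` of `|K|` mapping every simplex of `K` into itself with all `τ⁻¹(Xᵢ)` polyhedra* [Shiota2014, §2,
  "triangulation theorem of definable sets"]. The review merged both back into the parent's proof
  obligation and removed the two `def`s, for three reasons. (i) Each is a theory-sized theorem, not an
  intermediate lemma: the printed proofs rest on o-minimal cell decomposition, definable dimension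
  (`dim bd S < m + 1`), definable continuous extension, the good-directions lemma (via `C¹` cell
  decomposition) and the lifting lemmas for multivalued functions [Dries1998, Ch. 3, Ch. 4 (1.10), Ch. 7
  (4.2), Ch. 8 (2.1)–(2.8)], resp. on `C^r` `𝔛`-stratifications of maps and singular directions
  [Shiota1997, (II.1.17), Lemma II.2.2]; of all this the tree has only the Tarski–Seidenberg projection
  theorem (`Literature.ModelTheory.ExponentialFields.tarski_seidenberg_holds`). (ii) They do not cut the
  parent down to size: given both facts, the printed proofs of the Hauptvermutung still require, in
  [Shiota1997], `C^r` Whitney `𝔛`-stratifications of `𝔛`-homeomorphisms (II.1.15, II.1.19), controlled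
  `𝔛`-tube systems and the `𝔛`-triviality lemmas of §II.5–II.6 (II.5.1, II.6.9), `C^r`
  `𝔛`-triangulation approximations of strata, uniqueness of `C^∞` triangulations (I.3.13) and the PL
  theorems III.1.1–III.1.2 proved in §III.2 with the Alexander trick — existence (Thm. II.2.1) and
  uniqueness (Cor. III.1.4) are the two halves of Thm. II (loc. cit. p. 97, "we divide Theorem II into
  Theorems II.2.1, II.3.1 and Corollary III.1.4"), and II.2.1 enters the proof of III.1.4 only as an
  auxiliary (choice of the skeleta `X(l-1)` in the application of III.1.2); in [Shiota2014] the
  triangulation theorem is one quoted tool inside the proof of Thm. 2.1 (definable `C¹` stratifications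
  of maps II.1.17, singular directions II.2.2′, regular neighbourhoods, the Alexander trick). So a glue
  theorem deriving the Hauptvermutung from the two facts would itself be theory-sized. (iii) Neither
  fact had a consumer in the tree. A route that needs the triangulation theorem (e.g. a semialgebraic
  triangulation of `(X(ℂ), D(ℂ))` in the Kontsevich–Zagier cone) should request it as a cite item; the
  statements above, in this file's vocabulary
  (`Geometry.SimplicialComplex` + `faces.Finite`, `IsSemialgHomeomorphOn ℝ`, `openSimplex`,
  `IsPolyhedron`), were reviewed faithful to the cited places and can be re-vendored as printed here.
* No triangulation of semialgebraic *functions* ([Shiota1997, Thm. II.3.1]; [Shiota2014, Thm. 2.2 (1)]): in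
  both sources it is proved *using* the Hauptvermutung.
* Coefficients: the vocabulary is over a coefficient ring `k → ℝ` (`IsSemialgebraic k`), the cited
  statements are over `ℝ`, as printed.

## References (all read at the cited places)

* [Dries1998] L. van den Dries, *Tame topology and o-minimal structures* (1998): Ch. 2 (2.10)–(2.11);
  Ch. 7 (4.2); Ch. 8 (1.4), (1.5), (2.1)–(2.3), (2.6)–(2.8), Thm. (2.9) with its proof.
* [Shiota1997] M. Shiota, *Geometry of subanalytic and semialgebraic sets* (1997): §II.1 p. 97 (Thm. II
  and its division into II.2.1, II.3.1, III.1.4; (II.1.15), (II.1.17), (II.1.19)), Thm. II.2.1 with its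
  proof, Lemma II.2.2, Rem. II.2.4, Lemma II.2.7, Ch. III introduction, Thms. III.1.1–III.1.2,
  Cor. III.1.4 with its proof (II.5.1, II.6.9, I.3.13 as used there and in §III.2).
* [Shiota2014] M. Shiota, *O-minimal Hauptvermutung for polyhedra I*, Invent. Math. 196 (2014) 163–232
  (arXiv:1002.1508): §1–§2 (compact polyhedra, PL maps, Thm. 2.1 and its proof, the quoted triangulation
  theorem, Thm. 2.2).
-/

noncomputable section

open Set

namespace Literature.ModelTheory.ExponentialFields

/-! ### Open simplices -/

section OpenSimplex

variable (𝕜 : Type*) {E : Type*} [Field 𝕜] [LinearOrder 𝕜] [AddCommGroup E] [Module 𝕜 E]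

/-- The *open simplex* spanned by a finite set of points `s = {a₀, …, a_k}`:
`(a₀, …, a_k) = {∑ tᵢ aᵢ : all tᵢ > 0, ∑ tᵢ = 1}`; its closure (for affinely independent `s`) is the closed
simplex `[a₀, …, a_k] = convexHull s`. [cite: Dries1998, Ch. 8 (1.4)] -/
def openSimplex (s : Finset E) : Set E :=
  {x | ∃ w : E → 𝕜, (∀ y ∈ s, 0 < w y) ∧ ∑ y ∈ s, w y = 1 ∧ ∑ y ∈ s, w y • y = x}

variable {𝕜}

/-- Unfolding lemma for `openSimplex`. [cite: Dries1998, Ch. 8 (1.4)] -/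
theorem mem_openSimplex_iff {s : Finset E} {x : E} :
    x ∈ openSimplex 𝕜 s ↔
      ∃ w : E → 𝕜, (∀ y ∈ s, 0 < w y) ∧ ∑ y ∈ s, w y = 1 ∧ ∑ y ∈ s, w y • y = x :=
  Iff.rfl

variable [IsStrictOrderedRing 𝕜]

/-- An open simplex lies in the closed simplex `convexHull s`. [cite: Dries1998, Ch. 8 (1.4)] -/
theorem openSimplex_subset_convexHull (s : Finset E) :
    openSimplex 𝕜 s ⊆ convexHull 𝕜 (s : Set E) := by
  rintro x ⟨w, hw₀, hw₁, hx⟩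
  exact Finset.mem_convexHull'.2 ⟨w, fun y hy => (hw₀ y hy).le, hw₁, hx⟩

/-- The barycentre `∑ (#s)⁻¹ • aᵢ` lies in the open simplex; in particular a nonempty `s` spans a nonempty
open simplex. [cite: Dries1998, Ch. 8 (1.4)] -/
theorem openSimplex_nonempty {s : Finset E} (hs : s.Nonempty) : (openSimplex 𝕜 s).Nonempty := by
  have hcard : (0 : 𝕜) < s.card := Nat.cast_pos.2 hs.card_pos
  refine ⟨∑ y ∈ s, (s.card : 𝕜)⁻¹ • y, fun _ => (s.card : 𝕜)⁻¹, fun y _ => inv_pos.2 hcard, ?_, rfl⟩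
  rw [Finset.sum_const, nsmul_eq_mul]
  exact mul_inv_cancel₀ hcard.ne'

/-- The open `0`-simplex spanned by a point is the point. [cite: Dries1998, Ch. 8 (1.4)] -/
theorem openSimplex_singleton (a : E) : openSimplex 𝕜 ({a} : Finset E) = {a} := by
  ext x
  simp only [mem_openSimplex_iff, Finset.sum_singleton, Finset.mem_singleton, forall_eq,
    mem_singleton_iff]
  constructor
  · rintro ⟨w, -, hw₁, rfl⟩
    rw [hw₁, one_smul]
  · rintro rfl
    exact ⟨fun _ => 1, one_pos, rfl, by rw [one_smul]⟩

end OpenSimplex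

/-! ### Polyhedra: `|K|` of a finite simplicial complex -/

section Polyhedron

open Literature.Barriers.KontsevichZagierPeriods.PL

variable {d : ℕ}

/-- A finite union of simplices given by affinely independent vertex `Finset`s (the encoding of
`Geometry.SimplicialComplex.faces`) is a polyhedron in the sense of
`Literature.Barriers.KontsevichZagierPeriods.PL.IsPolyhedron` (`Fin (k+1)`-indexed vertex families):
drop the empty vertex sets and enumerate the others. [folklore] -/
theorem isPolyhedron_biUnion_convexHull {F : Finset (Finset (Fin d → ℝ))}
    (hF : ∀ s ∈ F, AffineIndependent ℝ ((↑) : s → Fin d → ℝ)) :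
    IsPolyhedron (⋃ s ∈ F, convexHull ℝ (s : Set (Fin d → ℝ))) := by
  classical
  -- the nonempty members of `F`, enumerated
  set F' := F.filter fun s => s.Nonempty with hF'
  have hU : (⋃ s ∈ F, convexHull ℝ (s : Set (Fin d → ℝ))) =
      ⋃ s ∈ F', convexHull ℝ (s : Set (Fin d → ℝ)) := by
    ext x
    simp only [mem_iUnion, exists_prop, hF', Finset.mem_filter]
    constructor
    · rintro ⟨s, hs, hx⟩
      have hne : s.Nonempty := by
        rw [← Finset.coe_nonempty]
        exact (convexHull_nonempty_iff (𝕜 := ℝ)).1 ⟨x, hx⟩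
      exact ⟨s, ⟨hs, hne⟩, hx⟩
    · rintro ⟨s, ⟨hs, -⟩, hx⟩
      exact ⟨s, hs, hx⟩
  rw [hU]
  let e := F'.equivFin
  let g : Fin F'.card → Finset (Fin d → ℝ) := fun j => (e.symm j).1
  refine ⟨F'.card, fun j => convexHull ℝ (g j : Set (Fin d → ℝ)), fun j => ?_, ?_⟩
  · -- each nonempty affinely independent vertex set spans a simplex
    show IsSimplex (convexHull ℝ (g j : Set (Fin d → ℝ)))
    have hsF' : g j ∈ F' := (e.symm j).2
    generalize g j = s at hsF' ⊢
    have hsF : s ∈ F := (Finset.mem_filter.1 hsF').1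
    have hsne : s.Nonempty := (Finset.mem_filter.1 hsF').2
    obtain ⟨k, hk⟩ : ∃ k, s.card = k + 1 := ⟨s.card - 1, (Nat.succ_pred_eq_of_pos hsne.card_pos).symm⟩
    let f : Fin (k + 1) ≃ s := (s.equivFinOfCardEq hk).symm
    refine ⟨k, fun l => (f l : Fin d → ℝ), (hF s hsF).comp_embedding f.toEmbedding, ?_⟩
    have hr : range (fun l => (f l : Fin d → ℝ)) = (s : Set (Fin d → ℝ)) := by
      ext y
      constructor
      · rintro ⟨l, rfl⟩
        exact (f l).2
      · intro hy
        exact ⟨f.symm ⟨y, hy⟩, by simp⟩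
    rw [hr]
  · ext x
    simp only [mem_iUnion, exists_prop]
    constructor
    · rintro ⟨s, hs, hx⟩
      refine ⟨e ⟨s, hs⟩, ?_⟩
      simpa [g] using hx
    · rintro ⟨j, hx⟩
      exact ⟨_, (e.symm j).2, hx⟩

/-- The polyhedron `|K| = K.space` of a finite (geometric) simplicial complex in `ℝᵈ` is a polyhedron
(finite union of its closed simplices). [cite: Dries1998, Ch. 8 (1.5)] -/
theorem isPolyhedron_space {K : Geometry.SimplicialComplex ℝ (Fin d → ℝ)} (hK : K.faces.Finite) :
    IsPolyhedron K.space := by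
  have h : K.space = ⋃ s ∈ hK.toFinset, convexHull ℝ (s : Set (Fin d → ℝ)) := by
    ext x
    simp only [Geometry.SimplicialComplex.mem_space_iff, mem_iUnion, Set.Finite.mem_toFinset,
      exists_prop]
  rw [h]
  exact isPolyhedron_biUnion_convexHull fun s hs => K.indep (hK.mem_toFinset.1 hs)

/-- The polyhedron of a simplicial complex contains the open simplices of its faces.
[cite: Dries1998, Ch. 8 (1.5)] -/
theorem openSimplex_subset_space {E : Type*} [AddCommGroup E] [Module ℝ E]
    {K : Geometry.SimplicialComplex ℝ E} {s : Finset E} (hs : s ∈ K.faces) :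
    openSimplex ℝ s ⊆ K.space :=
  (openSimplex_subset_convexHull s).trans (Geometry.SimplicialComplex.convexHull_subset_space hs)

/-- Polyhedra are compact (finite unions of convex hulls of finite sets); dot-notation extension of the
barrier file's `IsPolyhedron`, declared with its absolute name. [folklore] -/
theorem _root_.Literature.Barriers.KontsevichZagierPeriods.PL.IsPolyhedron.isCompact
    {P : Set (Fin d → ℝ)} (hP : IsPolyhedron P) : IsCompact P := by
  obtain ⟨n, σ, hσ, rfl⟩ := hP
  refine isCompact_iUnion fun i => ?_
  obtain ⟨k, v, -, hv⟩ := hσ i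
  rw [hv]
  exact (finite_range v).isCompact_convexHull ℝ

end Polyhedron

/-! ### Semialgebraic homeomorphisms -/

section Homeomorph

variable (k : Type*) [CommRing k] [Algebra k ℝ] {m n : ℕ}

/-- `Φ` restricts to a homeomorphism from `S ⊆ ℝᵐ` onto `T ⊆ ℝⁿ` with inverse `Ψ`, and the graph of `Φ`
over `S` is `k`-semialgebraic: for `k = ℝ` this is a *definable homeomorphism* `S → T` of the o-minimal
structure of semialgebraic sets ("a map belongs to `S` if its graph does" [cite: Dries1998, Ch. 8 (2.3)]),
i.e. an `𝔛`-homeomorphism for `𝔛` = the semialgebraic sets ("an `𝔛`-map is a continuous map between `𝔛`-sets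
whose graph is an `𝔛`-set", [Shiota1997, §II.1 p. 97]). The maps are total functions on the ambient spaces;
only their values on `S`, `T` matter. This is the maps-explicit form of the barrier file's
`Literature.Barriers.KontsevichZagierPeriods.PL.SemialgHomeomorphicOver k S T` (`= ∃ Φ Ψ, …`, which
records both graphs; one suffices: `IsSemialgHomeomorphOn.semialgHomeomorphicOver`,
`semialgHomeomorphicOver_iff_exists`). -/
def IsSemialgHomeomorphOn (S : Set (Fin m → ℝ)) (T : Set (Fin n → ℝ)) (Φ : (Fin m → ℝ) → (Fin n → ℝ))
    (Ψ : (Fin n → ℝ) → (Fin m → ℝ)) : Prop :=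
  MapsTo Φ S T ∧ MapsTo Ψ T S ∧ (∀ x ∈ S, Ψ (Φ x) = x) ∧ (∀ y ∈ T, Φ (Ψ y) = y) ∧
    ContinuousOn Φ S ∧ ContinuousOn Ψ T ∧
    Literature.NumberTheory.Transcendental.IsSemialgebraicMapOn k S Φ

variable {k}

/-- Flipping the two blocks of coordinates: `Fin.append x y ∘ finAddFlip = Fin.append y x` (Mathlib's
`finAddFlip : Fin (n + m) ≃ Fin (m + n)`; a general `Fin` lemma, kept in this file's namespace). [folklore] -/
theorem append_comp_finAddFlip {α : Type*} (x : Fin m → α) (y : Fin n → α) :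
    Fin.append x y ∘ (finAddFlip : Fin (n + m) ≃ Fin (m + n)) = Fin.append y x := by
  ext l
  refine Fin.addCases (fun j => ?_) (fun i => ?_) l
  · simp only [Function.comp_apply, finAddFlip_apply_castAdd, Fin.append_right, Fin.append_left]
  · simp only [Function.comp_apply, finAddFlip_apply_natAdd, Fin.append_left, Fin.append_right]

namespace IsSemialgHomeomorphOn

variable {S : Set (Fin m → ℝ)} {T : Set (Fin n → ℝ)} {Φ : (Fin m → ℝ) → (Fin n → ℝ)}
  {Ψ : (Fin n → ℝ) → (Fin m → ℝ)}

/-- `Φ` maps `S` into `T`. [cite: Dries1998, Ch. 8 (2.3)] -/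
theorem mapsTo (h : IsSemialgHomeomorphOn k S T Φ Ψ) : MapsTo Φ S T := h.1

/-- `Ψ` maps `T` into `S`. [cite: Dries1998, Ch. 8 (2.3)] -/
theorem mapsTo_symm (h : IsSemialgHomeomorphOn k S T Φ Ψ) : MapsTo Ψ T S := h.2.1

/-- `Ψ ∘ Φ = id` on `S`. [cite: Dries1998, Ch. 8 (2.3)] -/
theorem left_inv (h : IsSemialgHomeomorphOn k S T Φ Ψ) {x : Fin m → ℝ} (hx : x ∈ S) : Ψ (Φ x) = x :=
  h.2.2.1 x hx

/-- `Φ ∘ Ψ = id` on `T`. [cite: Dries1998, Ch. 8 (2.3)] -/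
theorem right_inv (h : IsSemialgHomeomorphOn k S T Φ Ψ) {y : Fin n → ℝ} (hy : y ∈ T) : Φ (Ψ y) = y :=
  h.2.2.2.1 y hy

/-- `Φ` is continuous on `S`. [cite: Dries1998, Ch. 8 (2.3)] -/
theorem continuousOn (h : IsSemialgHomeomorphOn k S T Φ Ψ) : ContinuousOn Φ S := h.2.2.2.2.1

/-- `Ψ` is continuous on `T`. [cite: Dries1998, Ch. 8 (2.3)] -/
theorem continuousOn_symm (h : IsSemialgHomeomorphOn k S T Φ Ψ) : ContinuousOn Ψ T := h.2.2.2.2.2.1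

/-- The graph of `Φ` over `S` is `k`-semialgebraic. [cite: Dries1998, Ch. 8 (2.3)] -/
theorem isSemialgebraicMapOn (h : IsSemialgHomeomorphOn k S T Φ Ψ) :
    Literature.NumberTheory.Transcendental.IsSemialgebraicMapOn k S Φ :=
  h.2.2.2.2.2.2

/-- `Φ(S) = T`. [cite: Dries1998, Ch. 8 (2.3)] -/
theorem image_eq (h : IsSemialgHomeomorphOn k S T Φ Ψ) : Φ '' S = T :=
  h.mapsTo.image_subset.antisymm fun y hy => ⟨Ψ y, h.mapsTo_symm hy, h.right_inv hy⟩

/-- The homeomorphism `S ≃ₜ T` underlying a semialgebraic homeomorphism. [cite: Dries1998, Ch. 8 (2.3)] -/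
def toHomeomorph (h : IsSemialgHomeomorphOn k S T Φ Ψ) : S ≃ₜ T where
  toFun := h.mapsTo.restrict Φ S T
  invFun := h.mapsTo_symm.restrict Ψ T S
  left_inv x := Subtype.ext (h.left_inv x.2)
  right_inv y := Subtype.ext (h.right_inv y.2)
  continuous_toFun := h.continuousOn.mapsToRestrict h.mapsTo
  continuous_invFun := h.continuousOn_symm.mapsToRestrict h.mapsTo_symm

/-- The value of the underlying homeomorphism. [cite: Dries1998, Ch. 8 (2.3)] -/
@[simp] theorem toHomeomorph_apply_coe (h : IsSemialgHomeomorphOn k S T Φ Ψ) (x : S) :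
    (h.toHomeomorph x : Fin n → ℝ) = Φ x :=
  rfl

/-- The graph of the inverse over `T` is the coordinate flip (`finAddFlip`) of the graph of `Φ` over `S`;
hence it is `k`-semialgebraic as well (semialgebraic sets are stable under coordinate permutations).
[folklore] -/
theorem isSemialgebraicMapOn_symm (h : IsSemialgHomeomorphOn k S T Φ Ψ) :
    Literature.NumberTheory.Transcendental.IsSemialgebraicMapOn k T Ψ := by
  have key : {z : Fin (n + m) → ℝ | ∃ y ∈ T, z = Fin.append y (Ψ y)} =
      (fun z : Fin (n + m) → ℝ => z ∘ (finAddFlip : Fin (m + n) ≃ Fin (n + m))) ⁻¹'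
        {z : Fin (m + n) → ℝ | ∃ x ∈ S, z = Fin.append x (Φ x)} := by
    ext z
    simp only [mem_setOf_eq, mem_preimage]
    constructor
    · rintro ⟨y, hy, rfl⟩
      refine ⟨Ψ y, h.mapsTo_symm hy, ?_⟩
      rw [append_comp_finAddFlip, h.right_inv hy]
    · rintro ⟨x, hx, hzx⟩
      refine ⟨Φ x, h.mapsTo hx, ?_⟩
      have hz : z = Fin.append (Φ x) x := by
        ext l
        refine Fin.addCases (fun j => ?_) (fun i => ?_) l
        · have := congr_fun hzx (Fin.natAdd m j)
          simp only [Function.comp_apply, finAddFlip_apply_natAdd, Fin.append_right] at this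
          rw [Fin.append_left, this]
        · have := congr_fun hzx (Fin.castAdd n i)
          simp only [Function.comp_apply, finAddFlip_apply_castAdd, Fin.append_left] at this
          rw [Fin.append_right, this]
      rw [hz, h.left_inv hx]
  have hΦ : IsSemialgebraic k {z : Fin (m + n) → ℝ | ∃ x ∈ S, z = Fin.append x (Φ x)} :=
    h.isSemialgebraicMapOn
  unfold Literature.NumberTheory.Transcendental.IsSemialgebraicMapOn
  rw [key]
  exact hΦ.preimage_comp _

/-- The inverse of a semialgebraic homeomorphism is a semialgebraic homeomorphism. [folklore] -/
theorem symm (h : IsSemialgHomeomorphOn k S T Φ Ψ) : IsSemialgHomeomorphOn k T S Ψ Φ :=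
  ⟨h.mapsTo_symm, h.mapsTo, fun _ hy => h.right_inv hy, fun _ hx => h.left_inv hx,
    h.continuousOn_symm, h.continuousOn, h.isSemialgebraicMapOn_symm⟩

/-- The identity is a semialgebraic homeomorphism of any `k`-semialgebraic set (its graph over `S` is
`k`-semialgebraic: `Literature.NumberTheory.Transcendental.isSemialgebraicMapOn_id`). [folklore] -/
theorem refl {S : Set (Fin m → ℝ)} (hS : IsSemialgebraic k S) : IsSemialgHomeomorphOn k S S id id :=
  ⟨mapsTo_id S, mapsTo_id S, fun _ _ => rfl, fun _ _ => rfl, continuousOn_id, continuousOn_id,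
    Literature.NumberTheory.Transcendental.isSemialgebraicMapOn_id hS⟩

/-- Bridge to the barrier file: a semialgebraic homeomorphism in the maps-explicit sense gives
`SemialgHomeomorphicOver k S T` (the second graph by `isSemialgebraicMapOn_symm`). [folklore] -/
theorem semialgHomeomorphicOver (h : IsSemialgHomeomorphOn k S T Φ Ψ) :
    Literature.Barriers.KontsevichZagierPeriods.PL.SemialgHomeomorphicOver k S T :=
  ⟨Φ, Ψ, h.mapsTo, h.mapsTo_symm, fun _ hx => h.left_inv hx, fun _ hy => h.right_inv hy,
    h.continuousOn, h.continuousOn_symm, h.isSemialgebraicMapOn, h.isSemialgebraicMapOn_symm⟩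

end IsSemialgHomeomorphOn

/-- `SemialgHomeomorphicOver k S T` (barrier file: both graphs semialgebraic) is the existence of a
semialgebraic homeomorphism `S → T` with ONE semialgebraic graph. [folklore] -/
theorem semialgHomeomorphicOver_iff_exists {S : Set (Fin m → ℝ)} {T : Set (Fin n → ℝ)} :
    Literature.Barriers.KontsevichZagierPeriods.PL.SemialgHomeomorphicOver k S T ↔
      ∃ (Φ : (Fin m → ℝ) → (Fin n → ℝ)) (Ψ : (Fin n → ℝ) → (Fin m → ℝ)),
        IsSemialgHomeomorphOn k S T Φ Ψ := by
  constructor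
  · rintro ⟨Φ, Ψ, hΦ, hΨ, hΨΦ, hΦΨ, hΦc, hΨc, hΦs, -⟩
    exact ⟨Φ, Ψ, hΦ, hΨ, hΨΦ, hΦΨ, hΦc, hΨc, hΦs⟩
  · rintro ⟨Φ, Ψ, h⟩
    exact h.semialgHomeomorphicOver

end Homeomorph

end Literature.ModelTheory.ExponentialFields
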